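import Summits.Parity.GeneralizedHardyLittlewood.Theorems.FordMaynardSieveConst01651SieveConst01651SignCut
import Summits.Parity.GeneralizedHardyLittlewood.Theorems.FordMaynardSieveConst01651SieveConst01651KernelForm
import HarnessLib

/-!
# Route `FordMaynardSieveConst01651`, target `SieveConst01651` (stmt-Parity-19185), line `sieve_decomposition`,
# stub `stub_coneCertClosed`, conjunct (iv) (the sign clause) BY DIMENSION

Def-free helper file.  Conjunct (iv) of `stub_coneCertClosed` asks `(𝟙⋆g₀)(x) = starSum g₀ k x ≤ 0` for every monotone
`x ∈ ℋ_k` (`ν < xᵢ < 1 − ν`, `|x| = 1`), `2 ≤ k ≤ 6`, for cone data `g₀` with `g₀(∅) = 1` and the CLOSED support clause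
(`g₀,ᵣ(y) ≠ 0`, `y` monotone ⇒ `r = 0` or all `yᵢ > ν` and `|y| ≤ 1/2`).  The certified LP table of the programme
(parity-ideate-p3, `spec_lp_01651_72.json`, item evidence) has `g₁ ≡ −1` on `(ν, 1/2]`, `g₂ ≤ 1` everywhere,
`g₂ ≤ −0.3077` on `(ν, 1−5ν]²` and `g₃ ≤ 0.9417`; this file shows that such TABLE FACTS already settle three of the five
dimensions, with no type enumeration:

* `starSum_two_nonpos` — `k = 2` ⟸ `g₁ ≤ −1` on `(ν, 1/2]` (the pair term dies: `|x| = 1 > 1/2`);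
* `starSum_three_nonpos` — `k = 3` ⟸ `g₁ ≤ −1` on `(ν, 1/2]` and `g₂ ≤ 1` on its support (only the pair `(x₁,x₂)` can
  have sum `≤ 1/2`, and then `x₃ ≥ 1/2` carries no `g₁`);
* `starSum_six_nonpos` — `k = 6` ⟸ `g₁ ≤ −1`, `g₂ ≤ −q` on `(ν, 1−5ν)²`, `g₃ ≤ p` (`|y| < 1/2`), `g₃ ≤ 0` (`|y| = 1/2`),
  `1/8 ≤ ν` and `−5 − 15q + 10p ≤ 0`: all six coordinates lie in `(ν, 1 − 5ν)`, the `15` pairs each give `≤ −q`, and the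
  `20` triples are paired with their complements (`|x_A| + |x_{Aᶜ}| = 1`, so at most one of the two is `< 1/2`), giving
  `≤ 10p`; subvectors of dimension `≥ 4` vanish (`4ν ≥ 1/2`).  For the table: `−5 − 15·0.307737 + 10·0.941613 = −0.20`.

What remains of (iv) after this file is `k = 4, 5` (the certifier's 55 225 + 86 966 open types).
Tools: `sum_orderEmb_eq` (`∑ᵢ (x_A)ᵢ = ∑_{i∈A} xᵢ`), `apply_subvector_eq_zero_of_half_lt` (support kills a subvector
term once `∑_{i∈A} xᵢ > 1/2`).

References: K. Ford, J. Maynard, *On the theory of prime producing sieves*, arXiv:2407.14368, Definition 7.1, (7.1),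
Theorem 7.3 (a), Lemma 8.4, §8.2. [FordMaynard2024PrimeSieves]
-/

noncomputable section

open Finset
open scoped Classical
open Literature.NumberTheory.Sieve Literature.NumberTheory.Sieve.FordMaynard

namespace Summit.Parity.GeneralizedHardyLittlewood.FordMaynardSieveConst01651SieveConst01651

/-! ### Subvector bookkeeping -/

/-- The entries of the increasing subvector `x_A` sum to `∑_{i ∈ A} xᵢ`. [folklore] -/
theorem sum_orderEmb_eq {k : ℕ} (x : Fin k → ℝ) (A : Finset (Fin k)) {n : ℕ} (h : A.card = n) :
    ∑ i : Fin n, x (A.orderEmbOfFin h i) = ∑ i ∈ A, x i := by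
  have hmap : (Finset.univ : Finset (Fin n)).map (A.orderEmbOfFin h).toEmbedding = A := by
    ext j
    simp only [Finset.mem_map, Finset.mem_univ, true_and, RelEmbedding.coe_toEmbedding]
    constructor
    · rintro ⟨i, rfl⟩
      exact A.orderEmbOfFin_mem h i
    · intro hj
      have : j ∈ Set.range (A.orderEmbOfFin h) := by
        rw [Finset.range_orderEmbOfFin]; exact hj
      obtain ⟨i, hi⟩ := this
      exact ⟨i, hi⟩
  conv_rhs => rw [← hmap]
  rw [Finset.sum_map]
  rfl

/-- Under the closed support clause a subvector term of positive dimension vanishes as soon as `∑_{i∈A} xᵢ > 1/2`.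
[cite: FordMaynard2024PrimeSieves, (7.1) (support of 𝒢₁: |y| ≤ 1/2)] -/
theorem apply_subvector_eq_zero_of_half_lt {ν : ℝ} {g₀ : VecFn}
    (hsupp : ∀ (r : ℕ) (y : Fin r → ℝ), Monotone y → g₀ r y ≠ 0 → r = 0 ∨ ((∀ i, ν < y i) ∧ ∑ i, y i ≤ 1 / 2))
    {k : ℕ} {x : Fin k → ℝ} (hx : Monotone x) (A : Finset (Fin k)) {n : ℕ} (h : A.card = n) (hn : n ≠ 0)
    (hs : 1 / 2 < ∑ i ∈ A, x i) :
    g₀ n (fun i => x (A.orderEmbOfFin h i)) = 0 := by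
  by_contra hne
  have hmono : Monotone (fun i => x (A.orderEmbOfFin h i)) := hx.comp (A.orderEmbOfFin h).monotone
  rcases hsupp _ _ hmono hne with h0 | ⟨-, hsum⟩
  · exact hn h0
  · rw [sum_orderEmb_eq x A h] at hsum
    linarith

/-- A singleton term is `g₁(xₐ)`: under the closed support clause and `g₁ ≤ −1` on `(ν, 1/2]` it is `≤ 0` always
and `≤ −1` when `xₐ ≤ 1/2`. [cite: FordMaynard2024PrimeSieves, Theorem 7.3 (a) (sign hypothesis), §8.2] -/
theorem apply_single_le {ν : ℝ} {g₀ : VecFn}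
    (hsupp : ∀ (r : ℕ) (y : Fin r → ℝ), Monotone y → g₀ r y ≠ 0 → r = 0 ∨ ((∀ i, ν < y i) ∧ ∑ i, y i ≤ 1 / 2))
    (hg1 : ∀ y : Fin 1 → ℝ, ν < y 0 → y 0 ≤ 1 / 2 → g₀ 1 y ≤ -1)
    {k : ℕ} {x : Fin k → ℝ} (hx : Monotone x) (hbox : ∀ i, ν < x i) (A : Finset (Fin k)) (h : A.card = 1) :
    g₀ 1 (fun i => x (A.orderEmbOfFin h i)) ≤ (if ∑ i ∈ A, x i ≤ 1 / 2 then -1 else 0) := by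
  have hsum := sum_orderEmb_eq x A h
  rw [Fin.sum_univ_one] at hsum
  split_ifs with hle
  · exact hg1 _ (hbox _) (by rw [hsum]; exact hle)
  · push Not at hle
    rw [apply_subvector_eq_zero_of_half_lt hsupp hx A h one_ne_zero hle]

/-! ### Dimension 2 -/

/-- **`k = 2`.** For cone data with `g₀(∅) = 1`, the closed support clause and `g₁ ≤ −1` on `(ν, 1/2]`:
`(𝟙⋆g₀)(x₁, x₂) ≤ 0` for monotone `x` with `xᵢ > ν` and `x₁ + x₂ = 1` (the pair term vanishes since `|x| = 1 > 1/2`,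
`g₁(x₁) ≤ −1`, and `g₁(x₂) ≤ 0`). [cite: FordMaynard2024PrimeSieves, Theorem 7.3 (a) and §8.2] -/
theorem starSum_two_nonpos {ν : ℝ} {g₀ : VecFn}
    (hsupp : ∀ (r : ℕ) (y : Fin r → ℝ), Monotone y → g₀ r y ≠ 0 → r = 0 ∨ ((∀ i, ν < y i) ∧ ∑ i, y i ≤ 1 / 2))
    (h0 : ∀ e : Fin 0 → ℝ, g₀ 0 e = 1)
    (hg1 : ∀ y : Fin 1 → ℝ, ν < y 0 → y 0 ≤ 1 / 2 → g₀ 1 y ≤ -1)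
    {x : Fin 2 → ℝ} (hx : Monotone x) (hbox : ∀ i, ν < x i) (hsum : ∑ i, x i = 1) :
    starSum g₀ 2 x ≤ 0 := by
  -- termwise bound `b A = c(|A|) − [A = {0}]`, `c(0) = 1`, `c(r) = 0` otherwise
  have hx01 : x 0 + x 1 = 1 := by rw [Fin.sum_univ_two] at hsum; exact hsum
  have hx0 : x 0 ≤ 1 / 2 := by have := hx (show (0 : Fin 2) ≤ 1 from Fin.zero_le _); linarith
  set c : ℕ → ℝ := fun r => if r = 0 then 1 else 0 with hc
  have hterm : ∀ A : Finset (Fin 2),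
      g₀ A.card (fun i => x (A.orderEmbOfFin rfl i)) ≤ c A.card + (if A = {0} then -1 else 0) := by
    intro A
    rcases Nat.lt_or_ge A.card 1 with hA | hA
    · have hA0 : A.card = 0 := by omega
      rw [← apply_orderEmb_cast' g₀ x A hA0, h0, hA0, Finset.card_eq_zero.1 hA0]
      simp [hc]
    rcases Nat.lt_or_ge A.card 2 with hA2 | hA2
    · have hA1 : A.card = 1 := by omega
      have hle := apply_single_le hsupp hg1 hx hbox A hA1
      rw [← apply_orderEmb_cast' g₀ x A hA1, hA1]
      by_cases hA' : A = {0}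
      · subst hA'
        rw [Finset.sum_singleton, if_pos hx0] at hle
        simp only [Finset.orderEmbOfFin_singleton] at hle
        simp [hc]; linarith
      · rw [if_neg hA']
        have : g₀ 1 (fun i => x (A.orderEmbOfFin hA1 i)) ≤ 0 := by
          refine hle.trans ?_; split_ifs <;> norm_num
        simpa [hc] using this
    · have hA2' : A.card = 2 := by
        have := A.card_le_univ; rw [Fintype.card_fin] at this; omega
      have hAu : A = Finset.univ := Finset.eq_univ_of_card A (by rw [Fintype.card_fin]; exact hA2')
      have hz := apply_subvector_eq_zero_of_half_lt hsupp hx A hA2' two_ne_zero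
        (by rw [hAu]; show (1 : ℝ) / 2 < ∑ i, x i; rw [hsum]; norm_num)
      rw [← apply_orderEmb_cast' g₀ x A hA2', hz, hA2']
      subst hAu
      rw [if_neg (by decide)]
      simp [hc]
  calc starSum g₀ 2 x = ∑ A : Finset (Fin 2), g₀ A.card (fun i => x (A.orderEmbOfFin rfl i)) := rfl
    _ ≤ ∑ A : Finset (Fin 2), (c A.card + (if A = {0} then -1 else 0)) := Finset.sum_le_sum fun A _ => hterm A
    _ = (∑ A : Finset (Fin 2), c A.card) + ∑ A : Finset (Fin 2), (if A = {0} then (-1 : ℝ) else 0) :=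
        Finset.sum_add_distrib
    _ = 1 + (-1) := by
        congr 1
        · rw [← Finset.powerset_univ, Finset.sum_powerset_apply_card]
          simp [hc, Finset.card_univ, Fintype.card_fin]
        · rw [Finset.sum_ite_eq']; simp
    _ ≤ 0 := by norm_num

/-! ### Dimension 3 -/

/-- **`k = 3`.** For cone data with `g₀(∅) = 1`, the closed support clause at `ν ≥ 0`, `g₁ ≤ −1` on `(ν, 1/2]` and
`g₂ ≤ 1` on monotone box pairs with `|y| ≤ 1/2`: `(𝟙⋆g₀)(x₁,x₂,x₃) ≤ 0` for monotone `x` with `xᵢ > ν`, `|x| = 1`.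
(The pairs `(x₁,x₃)`, `(x₂,x₃)` and the triple have sum `> 1/2`; if `x₃ > 1/2` the value is
`≤ 1 − 2 + g₂(x₁,x₂) ≤ 0`, otherwise `≤ 1 − 3 + 1`.) [cite: FordMaynard2024PrimeSieves, Theorem 7.3 (a) (sign hypothesis on ℋ), §8.2] -/
theorem starSum_three_nonpos {ν : ℝ} {g₀ : VecFn}
    (hsupp : ∀ (r : ℕ) (y : Fin r → ℝ), Monotone y → g₀ r y ≠ 0 → r = 0 ∨ ((∀ i, ν < y i) ∧ ∑ i, y i ≤ 1 / 2))
    (h0 : ∀ e : Fin 0 → ℝ, g₀ 0 e = 1)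
    (hg1 : ∀ y : Fin 1 → ℝ, ν < y 0 → y 0 ≤ 1 / 2 → g₀ 1 y ≤ -1)
    (hν : 0 ≤ ν)
    (hg2 : ∀ y : Fin 2 → ℝ, Monotone y → (∀ i, ν < y i) → ∑ i, y i ≤ 1 / 2 → g₀ 2 y ≤ 1)
    {x : Fin 3 → ℝ} (hx : Monotone x) (hbox : ∀ i, ν < x i) (hsum : ∑ i, x i = 1) :
    starSum g₀ 3 x ≤ 0 := by
  have h012 : x 0 + x 1 + x 2 = 1 := by rw [Fin.sum_univ_three] at hsum; exact hsum
  have h01 : x 0 ≤ x 1 := hx (by decide)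
  have h12 : x 1 ≤ x 2 := hx (by decide)
  have hx0 : 0 < x 0 := lt_of_le_of_lt hν (hbox 0)
  set term : Finset (Fin 3) → ℝ := fun A => g₀ A.card (fun i => x (A.orderEmbOfFin rfl i)) with hterm_def
  set c : ℕ → ℝ := fun r => if r = 0 then 1 else if r = 1 then -1 else 0 with hc
  set b : Finset (Fin 3) → ℝ := fun A =>
    c A.card + (if A = {0, 1} then 1 else 0) + (if A = {2} ∧ 1 / 2 < x 2 then 1 else 0) with hb
  have hterm : ∀ A : Finset (Fin 3), term A ≤ b A := by
    intro A
    simp only [hb]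
    have hb1 : 0 ≤ (if A = {0, 1} then (1 : ℝ) else 0) := by split_ifs <;> norm_num
    have hb2 : 0 ≤ (if A = {2} ∧ 1 / 2 < x 2 then (1 : ℝ) else 0) := by split_ifs <;> norm_num
    by_cases hA0 : A.card = 0
    · have : term A = 1 := by
        simp only [hterm_def]; rw [← apply_orderEmb_cast' g₀ x A hA0, h0]
      rw [this, hA0]
      have : c 0 = 1 := by simp [hc]
      rw [this]; linarith
    by_cases hA1 : A.card = 1
    · have hle := apply_single_le hsupp hg1 hx hbox A hA1
      have hc1 : c 1 = -1 := by simp [hc]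
      have htA : term A = g₀ 1 (fun i => x (A.orderEmbOfFin hA1 i)) := by
        simp only [hterm_def]; rw [← apply_orderEmb_cast' g₀ x A hA1]
      obtain ⟨a, rfl⟩ := Finset.card_eq_one.1 hA1
      rw [Finset.sum_singleton] at hle
      rw [hA1, hc1, htA]
      by_cases ha : x a ≤ 1 / 2
      · rw [if_pos ha] at hle; linarith
      · rw [if_neg ha] at hle
        push Not at ha
        have ha2 : a = 2 := by
          fin_cases a
          · exfalso; simp at ha; linarith
          · exfalso; simp at ha; linarith
          · rfl
        subst ha2
        have hP : ({2} : Finset (Fin 3)) = {2} ∧ 1 / 2 < x 2 := ⟨rfl, ha⟩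
        rw [if_pos hP]; linarith
    by_cases hA2 : A.card = 2
    · have htA : term A = g₀ 2 (fun i => x (A.orderEmbOfFin hA2 i)) := by
        simp only [hterm_def]; rw [← apply_orderEmb_cast' g₀ x A hA2]
      have hc2 : c 2 = 0 := by simp [hc]
      rw [hA2, hc2, htA]
      have hcases : A = {0, 1} ∨ A = {0, 2} ∨ A = {1, 2} := by
        have key : ∀ B : Finset (Fin 3), B.card = 2 → B = {0, 1} ∨ B = {0, 2} ∨ B = {1, 2} := by decide
        exact key A hA2
      rcases hcases with rfl | rfl | rfl
      · rw [if_pos rfl]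
        have : g₀ 2 (fun i => x (({0, 1} : Finset (Fin 3)).orderEmbOfFin hA2 i)) ≤ 1 := by
          by_cases hs : ∑ i ∈ ({0, 1} : Finset (Fin 3)), x i ≤ 1 / 2
          · exact hg2 _ (hx.comp (Finset.orderEmbOfFin _ hA2).monotone) (fun i => hbox _)
              (by rw [sum_orderEmb_eq x {0, 1} hA2]; exact hs)
          · push Not at hs
            rw [apply_subvector_eq_zero_of_half_lt hsupp hx {0, 1} hA2 two_ne_zero hs]; norm_num
        linarith
      · have hs : 1 / 2 < ∑ i ∈ ({0, 2} : Finset (Fin 3)), x i := by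
          rw [Finset.sum_pair (by decide)]; linarith
        rw [apply_subvector_eq_zero_of_half_lt hsupp hx {0, 2} hA2 two_ne_zero hs]; linarith
      · have hs : 1 / 2 < ∑ i ∈ ({1, 2} : Finset (Fin 3)), x i := by
          rw [Finset.sum_pair (by decide)]; linarith
        rw [apply_subvector_eq_zero_of_half_lt hsupp hx {1, 2} hA2 two_ne_zero hs]; linarith
    · have hA3 : A.card = 3 := by
        have := A.card_le_univ; rw [Fintype.card_fin] at this; omega
      have hAu : A = Finset.univ := Finset.eq_univ_of_card A (by rw [Fintype.card_fin]; exact hA3)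
      have hz : term A = 0 := by
        simp only [hterm_def]; rw [← apply_orderEmb_cast' g₀ x A hA3]
        exact apply_subvector_eq_zero_of_half_lt hsupp hx A hA3 (by norm_num)
          (by rw [hAu]; show (1 : ℝ) / 2 < ∑ i, x i; rw [hsum]; norm_num)
      have hc3 : c 3 = 0 := by simp [hc]
      rw [hz, hA3, hc3]; linarith
  have hconst : ∑ A : Finset (Fin 3), c A.card = 1 - 3 := by
    rw [← Finset.powerset_univ, Finset.sum_powerset_apply_card]
    simp [hc, Finset.sum_range_succ, Nat.choose, Finset.card_univ, Fintype.card_fin]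
    norm_num
  have hind1 : ∑ A : Finset (Fin 3), (if A = {0, 1} then (1 : ℝ) else 0) = 1 := by
    rw [Finset.sum_ite_eq']; simp
  have hind2 : ∑ A : Finset (Fin 3), (if A = {2} ∧ 1 / 2 < x 2 then (1 : ℝ) else 0) ≤ 1 := by
    by_cases hP : 1 / 2 < x 2
    · simp only [hP, and_true]; rw [Finset.sum_ite_eq']; simp
    · simp only [hP, and_false, if_false, Finset.sum_const_zero]; norm_num
  calc starSum g₀ 3 x = ∑ A : Finset (Fin 3), term A := rfl
    _ ≤ ∑ A : Finset (Fin 3), b A := Finset.sum_le_sum fun A _ => hterm A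
    _ = (∑ A : Finset (Fin 3), c A.card) + (∑ A : Finset (Fin 3), (if A = {0, 1} then (1 : ℝ) else 0)) +
          ∑ A : Finset (Fin 3), (if A = {2} ∧ 1 / 2 < x 2 then (1 : ℝ) else 0) := by
        simp only [hb, Finset.sum_add_distrib]
    _ ≤ (1 - 3) + 1 + 1 := by rw [hconst, hind1]; linarith
    _ ≤ 0 := by norm_num

/-! ### Dimension 6 -/

/-- Each coordinate of a box vector on the slice `|x| = 1` in dimension `6` is `< 1 − 5ν`. [folklore] -/
theorem apply_lt_of_six {ν : ℝ} {x : Fin 6 → ℝ} (hbox : ∀ i, ν < x i) (hsum : ∑ i, x i = 1) (i : Fin 6) :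
    x i < 1 - 5 * ν := by
  have h := Finset.add_sum_erase (Finset.univ : Finset (Fin 6)) x (Finset.mem_univ i)
  have hcard : (Finset.univ.erase i).card = 5 := by
    rw [Finset.card_erase_of_mem (Finset.mem_univ i), Finset.card_univ, Fintype.card_fin]
  have hlt : ∑ _j ∈ Finset.univ.erase i, ν < ∑ j ∈ Finset.univ.erase i, x j :=
    Finset.sum_lt_sum_of_nonempty (by rw [← Finset.card_pos, hcard]; norm_num) (fun j _ => hbox j)
  rw [Finset.sum_const, hcard, nsmul_eq_mul] at hlt
  push_cast at hlt
  linarith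

/-- **`k = 6`.** For cone data with `g₀(∅) = 1`, the closed support clause at `ν ≥ 1/8`, `g₁ ≤ −1` on `(ν, 1/2]`,
`g₂ ≤ −q` on monotone pairs in `(ν, 1 − 5ν)²`, `g₃ ≤ p` on monotone box triples with `|y| < 1/2` and `g₃ ≤ 0` on those
with `|y| = 1/2`, where `p ≥ 0` and `−5 − 15q + 10p ≤ 0`: `(𝟙⋆g₀)(x) ≤ 0` for every monotone `x ∈ ℝ⁶` with `xᵢ > ν`,
`|x| = 1`.  (Singletons give `−6`, the `15` pairs `≤ −15q`, the `20` triples, paired with their complements, `≤ 10p`;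
dimensions `≥ 4` vanish.)  For the programme's LP table at `ν = 0.1651`: `q = 0.307737`, `p = 0.941613`, value `−0.20`.
[cite: FordMaynard2024PrimeSieves, Theorem 7.3 (a) (sign hypothesis on ℋ), §8.2] -/
theorem starSum_six_nonpos {ν q p : ℝ} {g₀ : VecFn}
    (hsupp : ∀ (r : ℕ) (y : Fin r → ℝ), Monotone y → g₀ r y ≠ 0 → r = 0 ∨ ((∀ i, ν < y i) ∧ ∑ i, y i ≤ 1 / 2))
    (h0 : ∀ e : Fin 0 → ℝ, g₀ 0 e = 1)
    (hg1 : ∀ y : Fin 1 → ℝ, ν < y 0 → y 0 ≤ 1 / 2 → g₀ 1 y ≤ -1)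
    (hν : 1 / 8 ≤ ν)
    (hg2 : ∀ y : Fin 2 → ℝ, Monotone y → (∀ i, ν < y i) → (∀ i, y i < 1 - 5 * ν) → g₀ 2 y ≤ -q)
    (hg3 : ∀ y : Fin 3 → ℝ, Monotone y → (∀ i, ν < y i) → ∑ i, y i < 1 / 2 → g₀ 3 y ≤ p)
    (hg3' : ∀ y : Fin 3 → ℝ, Monotone y → (∀ i, ν < y i) → ∑ i, y i = 1 / 2 → g₀ 3 y ≤ 0)
    (hp : 0 ≤ p) (hqp : -5 - 15 * q + 10 * p ≤ 0)
    {x : Fin 6 → ℝ} (hx : Monotone x) (hbox : ∀ i, ν < x i) (hsum : ∑ i, x i = 1) :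
    starSum g₀ 6 x ≤ 0 := by
  have hlt : ∀ i, x i < 1 - 5 * ν := apply_lt_of_six hbox hsum
  have hhalf : ∀ i, x i ≤ 1 / 2 := fun i => by have := hlt i; linarith
  -- the subvector terms and the termwise bound
  set term : Finset (Fin 6) → ℝ := fun A => g₀ A.card (fun i => x (A.orderEmbOfFin rfl i)) with hterm_def
  set c : ℕ → ℝ := fun r => if r = 0 then 1 else if r = 1 then -1 else if r = 2 then -q else 0 with hc
  have hterm : ∀ A : Finset (Fin 6), term A ≤ c A.card + (if A.card = 3 then term A else 0) := by
    intro A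
    by_cases hA0 : A.card = 0
    · have : term A = 1 := by
        simp only [hterm_def]; rw [← apply_orderEmb_cast' g₀ x A hA0, h0]
      rw [this, hA0]; simp [hc]
    by_cases hA1 : A.card = 1
    · have hle := apply_single_le hsupp hg1 hx hbox A hA1
      obtain ⟨a, rfl⟩ := Finset.card_eq_one.1 hA1
      rw [Finset.sum_singleton, if_pos (hhalf a)] at hle
      have : term {a} ≤ -1 := by
        simp only [hterm_def]; rw [← apply_orderEmb_cast' g₀ x {a} hA1]; exact hle
      rw [hA1]; simp [hc]; linarith
    by_cases hA2 : A.card = 2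
    · have : term A ≤ -q := by
        simp only [hterm_def]; rw [← apply_orderEmb_cast' g₀ x A hA2]
        exact hg2 _ (hx.comp (A.orderEmbOfFin hA2).monotone) (fun i => hbox _) (fun i => hlt _)
      rw [hA2]; simp [hc]; linarith
    by_cases hA3 : A.card = 3
    · rw [if_pos hA3, hA3]; simp [hc]
    · have h4 : 4 ≤ A.card := by omega
      have hz : term A = 0 := by
        simp only [hterm_def]
        refine apply_subvector_eq_zero_of_card hsupp hx hbox A ?_
        have : (4 : ℝ) ≤ A.card := by exact_mod_cast h4
        nlinarith
      rw [hz, if_neg hA3]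
      have : c A.card = 0 := by simp only [hc]; rw [if_neg hA0, if_neg hA1, if_neg hA2]
      rw [this]; norm_num
  -- the constant part: `∑_A c(|A|) = 1 − 6 − 15q`
  have hconst : ∑ A : Finset (Fin 6), c A.card = 1 - 6 - 15 * q := by
    rw [← Finset.powerset_univ, Finset.sum_powerset_apply_card]
    simp [hc, Finset.sum_range_succ, Nat.choose, Finset.card_univ, Fintype.card_fin]
    ring
  -- the triple part, paired with complements
  set S : Finset (Finset (Fin 6)) := Finset.univ.filter (fun A => A.card = 3) with hS
  have hmemS : ∀ {A : Finset (Fin 6)}, A ∈ S ↔ A.card = 3 := by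
    intro A; simp [hS]
  have hcomplS : ∀ A ∈ S, Aᶜ ∈ S := by
    intro A hA
    rw [hmemS] at hA ⊢
    rw [Finset.card_compl, Fintype.card_fin, hA]
  have hswap : ∑ A ∈ S, term Aᶜ = ∑ A ∈ S, term A :=
    Finset.sum_nbij' (fun A => Aᶜ) (fun A => Aᶜ) hcomplS hcomplS (fun A _ => compl_compl A)
      (fun A _ => compl_compl A) (fun A _ => rfl)
  have hpair : ∀ A ∈ S, term A + term Aᶜ ≤ p := by
    intro A hA
    have h3 : A.card = 3 := hmemS.1 hA
    have h3c : Aᶜ.card = 3 := hmemS.1 (hcomplS A hA)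
    have hsc : ∑ i ∈ A, x i + ∑ i ∈ Aᶜ, x i = 1 := by rw [Finset.sum_add_sum_compl, hsum]
    have hA_eq : term A = g₀ 3 (fun i => x (A.orderEmbOfFin h3 i)) := by
      simp only [hterm_def]; rw [← apply_orderEmb_cast' g₀ x A h3]
    have hAc_eq : term Aᶜ = g₀ 3 (fun i => x (Aᶜ.orderEmbOfFin h3c i)) := by
      simp only [hterm_def]; rw [← apply_orderEmb_cast' g₀ x Aᶜ h3c]
    have hmA : Monotone (fun i => x (A.orderEmbOfFin h3 i)) := hx.comp (A.orderEmbOfFin h3).monotone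
    have hmAc : Monotone (fun i => x (Aᶜ.orderEmbOfFin h3c i)) := hx.comp (Aᶜ.orderEmbOfFin h3c).monotone
    have hsA := sum_orderEmb_eq x A h3
    have hsAc := sum_orderEmb_eq x Aᶜ h3c
    rcases lt_trichotomy (∑ i ∈ A, x i) (1 / 2) with hlt' | heq | hgt
    · have h1 : term A ≤ p := by
        rw [hA_eq]; exact hg3 _ hmA (fun i => hbox _) (by rw [hsA]; exact hlt')
      have h2 : term Aᶜ = 0 := by
        rw [hAc_eq]; exact apply_subvector_eq_zero_of_half_lt hsupp hx Aᶜ h3c (by norm_num) (by linarith)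
      linarith
    · have h1 : term A ≤ 0 := by
        rw [hA_eq]; exact hg3' _ hmA (fun i => hbox _) (by rw [hsA]; exact heq)
      have h2 : term Aᶜ ≤ 0 := by
        rw [hAc_eq]; exact hg3' _ hmAc (fun i => hbox _) (by rw [hsAc]; linarith)
      linarith
    · have h1 : term A = 0 := by
        rw [hA_eq]; exact apply_subvector_eq_zero_of_half_lt hsupp hx A h3 (by norm_num) hgt
      have h2 : term Aᶜ ≤ p := by
        rw [hAc_eq]; exact hg3 _ hmAc (fun i => hbox _) (by rw [hsAc]; linarith)
      linarith
  have hScard : S.card = 20 := by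
    have : S = Finset.powersetCard 3 (Finset.univ : Finset (Fin 6)) := by
      rw [Finset.powersetCard_eq_filter, Finset.powerset_univ]
    rw [this, Finset.card_powersetCard, Finset.card_univ, Fintype.card_fin]
    decide
  have htriples : ∑ A ∈ S, term A ≤ 10 * p := by
    have h2 : 2 * ∑ A ∈ S, term A = ∑ A ∈ S, (term A + term Aᶜ) := by
      rw [Finset.sum_add_distrib, hswap]; ring
    have h3 : ∑ A ∈ S, (term A + term Aᶜ) ≤ ∑ _A ∈ S, p := Finset.sum_le_sum hpair
    rw [Finset.sum_const, hScard, nsmul_eq_mul] at h3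
    push_cast at h3
    linarith
  -- assemble
  calc starSum g₀ 6 x = ∑ A : Finset (Fin 6), term A := rfl
    _ ≤ ∑ A : Finset (Fin 6), (c A.card + (if A.card = 3 then term A else 0)) :=
        Finset.sum_le_sum fun A _ => hterm A
    _ = (∑ A : Finset (Fin 6), c A.card) + ∑ A ∈ S, term A := by
        rw [Finset.sum_add_distrib, Finset.sum_filter]
    _ ≤ (1 - 6 - 15 * q) + 10 * p := by rw [hconst]; linarith
    _ ≤ 0 := by linarith

end Summit.Parity.GeneralizedHardyLittlewood.FordMaynardSieveConst01651SieveConst01651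

end
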